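import Summits.QuantumFields.BalabanUV.T4Continuum.Support.NE7ApeCurvedRepDockingStrong
import Summits.QuantumFields.BalabanUV.T4Continuum.Support.NE7CurvedLiftBookkeepingApproxFourTerm
import Summits.QuantumFields.BalabanUV.T4Continuum.Support.NE7TangentTransportSameTopDocked
import HarnessLib

/-!
# NE7ApeCurvedRepSameTopFourTerm — O2 RE-THREAD, FILE 3: `NE7ApeCurvedRepSameTopH` (the (APE) with a datum for a DISPLAYED fibre-preserving representative `U^u = W e^{Z}`,
# `cavgIter (j+1) (We^Z) = cavgIter (j+1) W`, normal lift `A_N` displayed) RE-CUT on the four-term root F153: `(S, hTS, hG)` ↦ the FOUR-TERM letter `h4` + `IsSkewDir A_N` + the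
# data `(σ, Ξ, D_v)` DISPLAYED on the displayed pair `(Z, A_N)`; conclusion gains `+ K_D·D_v + K_Ξ·Ξ` next to `K_X(α₀ + a_N)` (file 85 of the curved (APE), F155)

Cell `pub-balaban`, rung (B)+1 sub-cell t4, lineage `b2b-balaban-t4-ne7-p1` (CRUX PROVER NE7 #1 = OWNER of row NE7), generation 82; memo
`t4/b2b-balaban-t4-ne7-p1-g82/LOCALISATION-ROAD.md` §2 (O2).  Text-substitution twin of `NE7ApeCurvedRepSameTopH` (gen 80) over F153 `NE7CurvedLiftBookkeepingApproxFourTerm`; `hEXP` by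
F65, `hTT` by F75, gauge covariance by F58∕`smallField_of_gaugeAct_eq` exactly as there.
WHY.  This is the packaging the road-(B) files (`…SameTopCritical → …PointedGauge → …RoadB → …`) sit on: the representative `Z` is an INPUT here, so the four-term letter's data
are inputs too; downstream, `…PointedGauge`∕`…RoadB` will set `σ := σ̃` (the block-constant extension pointing the gauge) and supply `D_v` from E′'s divergence clause and the pointing
corrections (memo O2: bulk∕face pricing), `…RoadBLifted` supplies `A_N` (F111) — with the new obligations `IsSkewDir A_N`, `‖covDiv W A_N‖`.
WHAT ([folklore]; 0 def, 0 sorry).  **`smallField_of_tanCritical_repSameTop_fourTerm`**.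
HONEST FRAMING (page 1): composition over DISPLAYED letters; nothing of Bałaban's asserted; (APE) on curved data NOT proved; NOT ONE-STEP, NOT NE7; spine 0∕9; finite T⁴ rung (B)+1 —
NOT infinite volume, NOT mass gap, NOT `BetaPertH`, NOT Clay.  Continuum YM on T⁴ ⇐ BetaPertH ∧ nine spine estimates (0/9 proved); BetaPertH ⇐ (D1) ∧ (D4) ∧ CAP+tail; G-an2-4
gates asym, D1 and NE2/3/4.
-/

set_option autoImplicit false

open scoped BigOperators Matrix Matrix.Norms.L2Operator
open NormedSpace Finset Set

namespace Summit.QuantumFields.BalabanUV.T4Continuum.NE7ApeCurvedRepSameTopFourTerm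

open Literature.MathematicalPhysics.QuantumFieldTheory.Balaban1983to89
open B7Prop1Explicit B7Prop2Explicit MatrixLog UnitaryModel
open T4AveragingDeficitWall (Ad IsUnitaryCfg IsSkewDir SmallField vary curlAt dirL1)
open T4AveragingDeficitWallBoundary (IsPeriodicCfg periodBox)
open AveragingDeficitPeriodicCounting (IsPeriodicDir)
open AveragingDeficitTwoLevelPrep (twoLevelSmall)
open AveragingDeficitMultiLevelPrep (cavgIter LevelSmall)
open MinimalActionLevels (perWin)
open BlockAverageVaryHolo (nbRad)
open NE3HessForm (hess dAction)
open NE3TangentCovariantTower (dirIter)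
open NE3EnergyShapes (IsUnitarySite IsPeriodicSite)
open NE3QbarIterCovLiftPrep (cruxC)
open NE3RightInverseSolveLetters (thetaLoc)
open NE3HatInvCurlLetters (curl1C curl1C_nonneg)
open NE7TanCriticalGauge (tanCritical_gaugeAct)
open NE7ConvOneStepWeightedUnique (smallField_of_gaugeAct_eq)
open NE7CurvedLiftBookkeepingApproxFourTerm (smallField_vary_of_curvedLetters_approxFourTerm)
open NE7ExpansionRemainderCurvedStrong (abs_dAction_vary_sub_dAction_sub_hess_le_W_strong)
open NE7TangentTransportSameTopDocked (hTT_sameTop)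

open NE3CovariantWeitzenbock (covDiv)
open BlockAveragePushDirGauge (gaugeDir)

noncomputable section

variable {d : ℕ} {n : Type*} [Fintype n] [DecidableEq n]

/-- **(APE) WITH A DATUM FOR A FIBRE-PRESERVING REPRESENTATIVE, FOUR-TERM SLICE-SOLVER LETTER** — `NE7ApeCurvedRepSameTopH.smallField_of_tanCritical_repSameTop` with
`(S, hTS, hG)` replaced by the four-term letter `h4` (F152's shape), the normal lift's skewness `hNs`, and F153's DISPLAYED data: gauge parameter `σ` (skew periodic, `‖σ‖ ≤ Ξ`) and
divergence datum `‖covDiv W ((Z − A_N) + gaugeDir W σ)‖ ≤ D_v`; conclusion = the original radius `+ K_D·D_v + K_Ξ·Ξ`. [folklore] -/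
theorem smallField_of_tanCritical_repSameTop_fourTerm [Nonempty n] (hd : 2 ≤ d) {L N : ℕ} [NeZero N] (hL : 2 ≤ L) (j : ℕ)
    -- the background
    {W : Site d → Fin d → (Matrix n n ℂ)ˣ} {x : ℝ} (hWu : IsUnitaryCfg W) (hWP : IsPeriodicCfg W ((N * L ^ (j + 1) : ℕ) : ℤ))
    (hx : 0 ≤ x) (hs : LevelSmall d L j x) (hWx : SmallField W x)
    -- the sup radius of the representative and the regime at `x′ = x + 4(e^{α₀} − 1)`
    {α₀ : ℝ} (hα0 : 0 ≤ α₀) (hs' : LevelSmall d L j (x + 4 * (Real.exp α₀ - 1)))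
    (hθ : cruxC d L * (((L : ℝ) ^ (j + 1)) ^ 2 * (x + 4 * (Real.exp α₀ - 1))) < 1)
    (hθl : thetaLoc d L * (((L : ℝ) ^ (j + 1)) ^ 2 * (x + 4 * (Real.exp α₀ - 1))) < 1)
    (hε : ((L : ℝ) ^ (j + 1)) ^ 2 * (x + 4 * (Real.exp α₀ - 1)) ≤ 1)
    -- the field: of the class, tangent-critical
    {U : Site d → Fin d → (Matrix n n ℂ)ˣ} (hUu : IsUnitaryCfg U)
    {xU : ℝ} (hxU : 0 ≤ xU) (hsU : LevelSmall d L j xU) (hUxU : SmallField U xU)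
    (hcritU : ∀ Y : Site d → Fin d → Matrix n n ℂ, IsSkewDir Y → IsPeriodicDir Y ((N * L ^ (j + 1) : ℕ) : ℤ) →
      dirIter L (j + 1) U Y = 0 → dAction U Y (perWin d (N * L ^ (j + 1))) = 0)
    -- the DISPLAYED fibre-preserving representative `U^u = W e^{Z}`
    {u : Site d → (Matrix n n ℂ)ˣ} (huU : IsUnitarySite u) (huP : IsPeriodicSite u ((N * L ^ (j + 1) : ℕ) : ℤ))
    {Z : Site d → Fin d → Matrix n n ℂ} (hZs : IsSkewDir Z) (hZP : IsPeriodicDir Z ((N * L ^ (j + 1) : ℕ) : ℤ))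
    (hrep : gaugeAct u U = vary W Z 1) (hZα : ∀ y μ, ‖Z y μ‖ ≤ α₀)
    (hTopZ : cavgIter L (j + 1) (vary W Z 1) = cavgIter L (j + 1) W)
    -- the remaining analytic letters at `W`: (L1) normal lift of `Z`, the gradient member, (L2) slice solver, (L3) tension
    {cN aN KG KX KD KΞ κ ν : ℝ} (hκ : 0 ≤ κ) (hν : 0 ≤ ν)
    {AN : Site d → Fin d → Matrix n n ℂ} (hNP : IsPeriodicDir AN ((N * L ^ (j + 1) : ℕ) : ℤ)) (hNsup : ∀ y μ, ‖AN y μ‖ ≤ aN)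
    (hNexact : dirIter L (j + 1) W AN = dirIter L (j + 1) W Z)
    (hN7 : ∀ z μ' ν', μ' ≠ ν' → ‖curlAt W AN z μ' ν'‖ ≤ cN)
    (hNorth : ∀ Y : Site d → Fin d → Matrix n n ℂ, IsSkewDir Y → IsPeriodicDir Y ((N * L ^ (j + 1) : ℕ) : ℤ) → dirIter L (j + 1) W Y = 0 →
      |hess W AN Y (perWin d (N * L ^ (j + 1)))| ≤ ν * dirL1 Y (periodBox (d := d) (N * L ^ (j + 1))))
    (hNs : IsSkewDir AN)
    -- the END's known gauge part `σ` and the divergence datum of the re-gauged difference field (memo O2; F153's data, DISPLAYED at this level)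
    {σ : Site d → Matrix n n ℂ} (hσs : ∀ y, σ y ∈ skewAdjoint (Matrix n n ℂ))
    (hσP : ∀ (y : Site d) (i : Fin d), σ (y + ((N * L ^ (j + 1) : ℕ) : ℤ) • e i) = σ y) {Ξ : ℝ} (hσΞ : ∀ y, ‖σ y‖ ≤ Ξ)
    {Dv : ℝ} (hDv : ∀ y, ‖covDiv W (fun z κ => (Z z κ - AN z κ) + gaugeDir W σ z κ) y‖ ≤ Dv)
    {α₁ : ℝ} (hα1 : 0 ≤ α₁) (hZ1 : ∀ (y : Site d) (κ τ : Fin d), ‖Ad (W (y + e κ) τ) (Z (y + e τ) κ) - Z y κ‖ ≤ α₁)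
    -- THE FOUR-TERM SLICE-SOLVER LETTER (F152's shape) on all skew periodic `W`-tangent fields
    (h4 : ∀ X : Site d → Fin d → Matrix n n ℂ, IsSkewDir X →
      IsPeriodicDir X ((N * L ^ (j + 1) : ℕ) : ℤ) → dirIter L (j + 1) W X = 0 → ∀ R : ℝ, (∀ y κ', ‖X y κ'‖ ≤ R) → ∀ g : ℝ, 0 ≤ g →
      (∀ Y : Site d → Fin d → Matrix n n ℂ, IsSkewDir Y → IsPeriodicDir Y ((N * L ^ (j + 1) : ℕ) : ℤ) → dirIter L (j + 1) W Y = 0 →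
        |hess W X Y (perWin d (N * L ^ (j + 1)))| ≤ g * dirL1 Y (periodBox (d := d) (N * L ^ (j + 1)))) →
      ∀ σ' : Site d → Matrix n n ℂ, (∀ y, σ' y ∈ skewAdjoint (Matrix n n ℂ)) →
      (∀ (y : Site d) (i : Fin d), σ' (y + ((N * L ^ (j + 1) : ℕ) : ℤ) • e i) = σ' y) → ∀ Ξ' : ℝ, (∀ y, ‖σ' y‖ ≤ Ξ') →
      ∀ D : ℝ, (∀ y, ‖covDiv W (fun z κ => X z κ + gaugeDir W σ' z κ) y‖ ≤ D) →
      ∀ z μ' ν', μ' ≠ ν' → ‖curlAt W X z μ' ν'‖ ≤ KG * g + KX * R + KD * D + KΞ * Ξ')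
    (hWten : ∀ Y : Site d → Fin d → Matrix n n ℂ, IsSkewDir Y → IsPeriodicDir Y ((N * L ^ (j + 1) : ℕ) : ℤ) → dirIter L (j + 1) W Y = 0 →
      |dAction W Y (perWin d (N * L ^ (j + 1)))| ≤ κ * dirL1 Y (periodBox (d := d) (N * L ^ (j + 1)))) :
    SmallField U (x + (KG * (
        ((x + 4 * (Real.exp α₀ - 1))
            * ((curl1C d L / (1 - thetaLoc d L * (((L : ℝ) ^ (j + 1)) ^ 2 * (x + 4 * (Real.exp α₀ - 1)))))
                * (((L : ℝ) ^ (j + 1)) ^ d / ((L : ℝ) ^ (j + 1)) ^ 2))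
            * (Real.exp (((L : ℝ) ^ d / L) * ((d : ℝ) * (16 * ((d : ℝ) + 1) * ((d : ℝ) + 4) * (L : ℝ) ^ 2)
                  * (1250 * ((nbRad d L : ℝ) + L) + 8 * ((d : ℝ) * L) + 2 * L)) * (2 / twoLevelSmall d L))
                * ((L : ℝ) / (L : ℝ) ^ d) ^ j
                * (((d : ℝ) * (2 * nbRad d L + 1) ^ d) * ((2 * (d : ℝ) + 4) * (L : ℝ) ^ 2) * (2 * (L : ℝ) ^ j) * (Real.exp α₀ - 1)
                  + (17 / 8 * ((L : ℝ) ^ 2) ^ j * (x + 4 * (Real.exp α₀ - 1)))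
                    * (((d : ℝ) * (2 * nbRad d L + 1) ^ d) * ((2 * (d : ℝ) + 4)
                          * (2 * (2 * L * (nbRad d L : ℝ) + 128 * ((d : ℝ) + 1) * ((d : ℝ) + 4) * (L : ℝ) ^ 2)))
                      + ((d : ℝ) * (2 * nbRad d L + 1) ^ d) * ((2 * (d : ℝ) + 4) * (L : ℝ) ^ 2 * (2 * (nbRad d L : ℝ))
                          + 2 * (8 * (L : ℝ) + (1250 * ((nbRad d L : ℝ) + L) + 8 * (d * L) + 2 * L))
                              * (16 * ((d : ℝ) + 1) * ((d : ℝ) + 4) * (L : ℝ) ^ 2))))))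
        + (Fintype.card (T4AveragingDeficitWall.Plane d) : ℝ)
          * (2 * (240 * (Real.exp α₀ - 1) * α₀ * (2 * α₁ + 24 * α₀ * (Real.exp α₀ - 1) + x) + 8 * α₀ * (2 * α₁ + 24 * α₀ * (Real.exp α₀ - 1))
              + 6 * (Real.exp α₀ - 1) * (2 * α₁ + 24 * (Real.exp α₀ - 1) * α₀)
              + (2 * α₁ + 24 * (Real.exp α₀ - 1) * α₀) * (2 * α₁ + 24 * α₀ * (Real.exp α₀ - 1))
              + 960 * (Real.exp α₀ - 1) * α₀ ^ 2 + 32 * x * α₀ ^ 2)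
            + (64 * α₀ * α₁ + 1024 * x * α₀ ^ 2))
        + κ + ν) + KX * (α₀ + aN) + KD * Dv + KΞ * Ξ + cN + 28 * α₀ ^ 2)) := by
  have hL1 : 1 ≤ L := by omega
  have hP : 1 ≤ N * L ^ (j + 1) := Nat.mul_pos (Nat.pos_of_ne_zero (NeZero.ne N)) (Nat.pow_pos (by omega))
  have he0 : 0 ≤ Real.exp α₀ - 1 := by have := Real.add_one_le_exp α₀; linarith
  -- hEXP by F65 (strong curved remainder)
  have hρ0 : 0 ≤ (Fintype.card (T4AveragingDeficitWall.Plane d) : ℝ)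
          * (2 * (240 * (Real.exp α₀ - 1) * α₀ * (2 * α₁ + 24 * α₀ * (Real.exp α₀ - 1) + x) + 8 * α₀ * (2 * α₁ + 24 * α₀ * (Real.exp α₀ - 1))
              + 6 * (Real.exp α₀ - 1) * (2 * α₁ + 24 * (Real.exp α₀ - 1) * α₀)
              + (2 * α₁ + 24 * (Real.exp α₀ - 1) * α₀) * (2 * α₁ + 24 * α₀ * (Real.exp α₀ - 1))
              + 960 * (Real.exp α₀ - 1) * α₀ ^ 2 + 32 * x * α₀ ^ 2)
            + (64 * α₀ * α₁ + 1024 * x * α₀ ^ 2)) := by positivity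
  have hEXP : ∀ Y : Site d → Fin d → Matrix n n ℂ, IsSkewDir Y → IsPeriodicDir Y ((N * L ^ (j + 1) : ℕ) : ℤ) →
      |dAction (vary W Z 1) Y (perWin d (N * L ^ (j + 1))) - dAction W Y (perWin d (N * L ^ (j + 1))) - hess W Z Y (perWin d (N * L ^ (j + 1)))|
        ≤ (Fintype.card (T4AveragingDeficitWall.Plane d) : ℝ)
          * (2 * (240 * (Real.exp α₀ - 1) * α₀ * (2 * α₁ + 24 * α₀ * (Real.exp α₀ - 1) + x) + 8 * α₀ * (2 * α₁ + 24 * α₀ * (Real.exp α₀ - 1))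
              + 6 * (Real.exp α₀ - 1) * (2 * α₁ + 24 * (Real.exp α₀ - 1) * α₀)
              + (2 * α₁ + 24 * (Real.exp α₀ - 1) * α₀) * (2 * α₁ + 24 * α₀ * (Real.exp α₀ - 1))
              + 960 * (Real.exp α₀ - 1) * α₀ ^ 2 + 32 * x * α₀ ^ 2)
            + (64 * α₀ * α₁ + 1024 * x * α₀ ^ 2))
          * dirL1 Y (periodBox (d := d) (N * L ^ (j + 1))) :=
    fun Y _ hYP => abs_dAction_vary_sub_dAction_sub_hess_le_W_strong hP hWu hWP hx hWx hZs hZP hα0 hα1 hZα hZ1 hYP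
  -- tangent-criticality is gauge covariant
  have hcrit' : ∀ Y' : Site d → Fin d → Matrix n n ℂ, IsSkewDir Y' → IsPeriodicDir Y' ((N * L ^ (j + 1) : ℕ) : ℤ) →
      dirIter L (j + 1) (vary W Z 1) Y' = 0 → dAction (vary W Z 1) Y' (perWin d (N * L ^ (j + 1))) = 0 := by
    rw [← hrep]
    exact tanCritical_gaugeAct hL1 j hUu hxU hsU hUxU huU huP hcritU
  -- hTT by F75 (fibre-preserving representative)
  have hTT := hTT_sameTop hd hL j hWu hWP hx hα0 hWx hs' hθ hθl hε Z hZs hZP hZα hTopZ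
  -- the transport constant is nonnegative
  set e1 : ℝ := Real.exp α₀ - 1 with he1
  have hden : 0 < 1 - thetaLoc d L * (((L : ℝ) ^ (j + 1)) ^ 2 * (x + 4 * e1)) := by linarith
  have hc1 := curl1C_nonneg d L
  have htw : 0 < twoLevelSmall d L := by unfold twoLevelSmall; positivity
  have hτ : 0 ≤ ((x + 4 * e1)
            * ((curl1C d L / (1 - thetaLoc d L * (((L : ℝ) ^ (j + 1)) ^ 2 * (x + 4 * e1))))
                * (((L : ℝ) ^ (j + 1)) ^ d / ((L : ℝ) ^ (j + 1)) ^ 2))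
            * (Real.exp (((L : ℝ) ^ d / L) * ((d : ℝ) * (16 * ((d : ℝ) + 1) * ((d : ℝ) + 4) * (L : ℝ) ^ 2)
                  * (1250 * ((nbRad d L : ℝ) + L) + 8 * ((d : ℝ) * L) + 2 * L)) * (2 / twoLevelSmall d L))
                * ((L : ℝ) / (L : ℝ) ^ d) ^ j
                * (((d : ℝ) * (2 * nbRad d L + 1) ^ d) * ((2 * (d : ℝ) + 4) * (L : ℝ) ^ 2) * (2 * (L : ℝ) ^ j) * e1
                  + (17 / 8 * ((L : ℝ) ^ 2) ^ j * (x + 4 * e1))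
                    * (((d : ℝ) * (2 * nbRad d L + 1) ^ d) * ((2 * (d : ℝ) + 4)
                          * (2 * (2 * L * (nbRad d L : ℝ) + 128 * ((d : ℝ) + 1) * ((d : ℝ) + 4) * (L : ℝ) ^ 2)))
                      + ((d : ℝ) * (2 * nbRad d L + 1) ^ d) * ((2 * (d : ℝ) + 4) * (L : ℝ) ^ 2 * (2 * (nbRad d L : ℝ))
                          + 2 * (8 * (L : ℝ) + (1250 * ((nbRad d L : ℝ) + L) + 8 * (d * L) + 2 * L))
                              * (16 * ((d : ℝ) + 1) * ((d : ℝ) + 4) * (L : ℝ) ^ 2)))))) := by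
    have h1 : 0 ≤ curl1C d L / (1 - thetaLoc d L * (((L : ℝ) ^ (j + 1)) ^ 2 * (x + 4 * e1))) := div_nonneg hc1 hden.le
    positivity
  -- F59 on the representative
  have hXs : IsSkewDir (fun y μ => Z y μ - AN y μ) := fun y μ => (skewAdjoint (Matrix n n ℂ)).sub_mem (hZs y μ) (hNs y μ)
  have hSF := smallField_vary_of_curvedLetters_approxFourTerm hL1 j hWu hx hs hWx hZs hZP hZα hNP hNsup hNexact hN7 hν hNorth hXs h4 hσs hσP hσΞ hDv
    hρ0 hEXP hκ hWten hcrit' hτ hTT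
  -- the radius is gauge invariant
  exact smallField_of_gaugeAct_eq huU hrep hSF

end

end Summit.QuantumFields.BalabanUV.T4Continuum.NE7ApeCurvedRepSameTopFourTerm
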